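import Mathlib
import Literature.Geometry.Lorentzian.TameGenericityLocal

/-!
# Sketch for crux idea `silence-or-corner` (crux stmt-FinalStateConjecture-17329, round 2, ideator 5)

First lemmas of the line "Tangency only at silence: a radiating extremal threshold is a one-sided
CORNER of the final-state map, and uniform one-sided corners are δ-separated".

Dictionary (physics ↦ the real-variable objects below).  Through an exceptional (asymptotically
extremal, censored) datum `d` run a tame pencil `c ↦ F c`, `F 0 = d`.  On the hole-keeping stratum
the final Kerr parameters give the EXTREMALITY DEFECT `D c := M_f(c)² − |J_f(c)| ≥ 0`, `D 0 = 0`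
(no over-extremal Kerr end state: censorship).  Linear perturbation theory predicts the two-sided
slope `−ℓ(f)`, `ℓ(f) = 2 M_f δE_rad[f] − δJ_rad[f]` = the K-weighted INTERFERENCE of the datum's own
news with the linearised news of `f` (ADM charges are fixed along compactly supported pencils), which
is non-zero for some `f` iff `d` radiates at all.

* §1 `corner`: a non-negative function vanishing at `0` has one-sided derivatives of opposite signs;
  hence a two-sided derivative is `0` (`tangency` — the first law at zero temperature, the case of a
  SILENT datum, `ℓ ≡ 0`, which is the Kehle–Unger / exactly-Kerr-outside stratum handed to the
  companion line kflux-seeds-the-ratchet), and a non-zero linear response `−ℓ` can be the derivative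
  on AT MOST ONE side (`not_hasDerivWithinAt_Ioi_of_pos`): the other side is a corner.
* §2 `isolated_of_uniform_clean_left`: if every bad parameter near `0` has a CLEAN left
  neighbourhood of uniform length `δ` (the good side of the corner, realised with a radius uniform
  along the threshold), bad parameters are `δ`-separated, so `0` is an ISOLATED bad parameter —
  whatever happens on the bad side (jump of the horizon, loss of the hole, non-perturbative
  saturation) is never inspected.
* §3 `isTameChristodoulouGeneric_of_uniform_clean_side`: the data-level assembly over the tree's
  `InitialDataSet.IsTameChristodoulouGeneric` — through every exceptional datum a tame, immersed,
  injective admissible pencil with the uniform-clean-side property ⇒ tame genericity (codimension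
  `1`), via the tree's locality lemma `isTameChristodoulouGeneric_of_local` (radial / tanh
  reparametrisation).  This is the shape in which the physical stubs of the line (K0 radiating ⇒
  `ℓ ≢ 0`; K2 uniform good-side validity) are consumed; nothing analytic about Einstein's equations
  is claimed here.

All statements are folklore real analysis / bookkeeping; `lean check` rc 0, 0 sorries expected.
-/

open Filter Set Topology Function
open scoped Topology

namespace Summit.FinalStateConjecture.FinalStateConjecture.Cruxes.TameCensorshipCollarMargin.SilenceOrCorner

/-! ### §1 The corner lemma -/

/-- Right derivative of a non-negative function at a zero is `≥ 0`. [folklore] -/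
theorem rightDeriv_nonneg {D : ℝ → ℝ} {r : ℝ} (h0 : D 0 = 0)
    (hnn : ∀ᶠ c in 𝓝[>] (0 : ℝ), 0 ≤ D c) (hr : HasDerivWithinAt D r (Ioi 0) 0) : 0 ≤ r := by
  rw [hasDerivWithinAt_iff_tendsto_slope] at hr
  have hs : Ioi (0 : ℝ) \ {0} = Ioi 0 := by
    ext x
    simp only [Set.mem_diff, mem_Ioi, mem_singleton_iff, and_iff_left_iff_imp]
    exact fun hx ↦ ne_of_gt hx
  rw [hs] at hr
  refine ge_of_tendsto hr ?_
  filter_upwards [hnn, self_mem_nhdsWithin] with c hc hpos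
  rw [slope_def_field, h0, sub_zero, sub_zero]
  exact div_nonneg hc (le_of_lt hpos)

/-- Left derivative of a non-negative function at a zero is `≤ 0`. [folklore] -/
theorem leftDeriv_nonpos {D : ℝ → ℝ} {l : ℝ} (h0 : D 0 = 0)
    (hnn : ∀ᶠ c in 𝓝[<] (0 : ℝ), 0 ≤ D c) (hl : HasDerivWithinAt D l (Iio 0) 0) : l ≤ 0 := by
  rw [hasDerivWithinAt_iff_tendsto_slope] at hl
  have hs : Iio (0 : ℝ) \ {0} = Iio 0 := by
    ext x
    simp only [Set.mem_diff, mem_Iio, mem_singleton_iff, and_iff_left_iff_imp]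
    exact fun hx ↦ ne_of_lt hx
  rw [hs] at hl
  refine le_of_tendsto hl ?_
  filter_upwards [hnn, self_mem_nhdsWithin] with c hc hneg
  rw [slope_def_field, h0, sub_zero, sub_zero]
  exact div_nonpos_iff.mpr (Or.inl ⟨hc, le_of_lt hneg⟩)

/-- **Corner lemma.** A function which is non-negative near `0` and vanishes at `0` — the
extremality defect `M_f² − |J_f|` along a pencil through a threshold datum — has one-sided
derivatives of OPPOSITE signs: `l ≤ 0 ≤ r`. [folklore] -/
theorem corner {D : ℝ → ℝ} {r l : ℝ} (h0 : D 0 = 0) (hnn : ∀ᶠ c in 𝓝 (0 : ℝ), 0 ≤ D c)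
    (hr : HasDerivWithinAt D r (Ioi 0) 0) (hl : HasDerivWithinAt D l (Iio 0) 0) :
    l ≤ 0 ∧ 0 ≤ r :=
  ⟨leftDeriv_nonpos h0 (hnn.filter_mono nhdsWithin_le_nhds) hl,
    rightDeriv_nonneg h0 (hnn.filter_mono nhdsWithin_le_nhds) hr⟩

/-- **Tangency** (the first law at zero temperature, abstractly): if the defect is DIFFERENTIABLE at
the threshold its derivative vanishes.  This is the case of a SILENT datum (`ℓ ≡ 0`). [folklore] -/
theorem tangency {D : ℝ → ℝ} {ℓ : ℝ} (h0 : D 0 = 0) (hnn : ∀ᶠ c in 𝓝 (0 : ℝ), 0 ≤ D c)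
    (h : HasDerivAt D ℓ 0) : ℓ = 0 := by
  obtain ⟨h₁, h₂⟩ := corner h0 hnn h.hasDerivWithinAt h.hasDerivWithinAt
  exact le_antisymm h₁ h₂

/-- **No two-sided linear response.** If the linearised prediction `−ℓ` were the derivative on BOTH
sides, then `ℓ = 0`: a radiating threshold (`ℓ ≠ 0`) is a corner of the final-state map.
[folklore] -/
theorem eq_zero_of_twoSided_response {D : ℝ → ℝ} {ℓ : ℝ} (h0 : D 0 = 0)
    (hnn : ∀ᶠ c in 𝓝 (0 : ℝ), 0 ≤ D c) (hr : HasDerivWithinAt D (-ℓ) (Ioi 0) 0)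
    (hl : HasDerivWithinAt D (-ℓ) (Iio 0) 0) : ℓ = 0 := by
  obtain ⟨h₁, h₂⟩ := corner h0 hnn hr hl
  linarith

/-- **The clean side is forced.** With `ℓ > 0` the linearised response `D c ≈ −ℓ c` cannot be the
right derivative (it would make the defect negative for `c > 0`): linear theory can only be valid
on the LEFT, where it predicts `D c ≈ ℓ |c| > 0` — sub-extremal at first order. [folklore] -/
theorem not_hasDerivWithinAt_Ioi_of_pos {D : ℝ → ℝ} {ℓ : ℝ} (h0 : D 0 = 0)
    (hnn : ∀ᶠ c in 𝓝 (0 : ℝ), 0 ≤ D c) (hℓ : 0 < ℓ) : ¬ HasDerivWithinAt D (-ℓ) (Ioi 0) 0 := by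
  intro hr
  have := rightDeriv_nonneg h0 (hnn.filter_mono nhdsWithin_le_nhds) hr
  linarith

/-- Symmetric statement: with `ℓ < 0` the linear response cannot be the LEFT derivative. [folklore] -/
theorem not_hasDerivWithinAt_Iio_of_neg {D : ℝ → ℝ} {ℓ : ℝ} (h0 : D 0 = 0)
    (hnn : ∀ᶠ c in 𝓝 (0 : ℝ), 0 ≤ D c) (hℓ : ℓ < 0) : ¬ HasDerivWithinAt D (-ℓ) (Iio 0) 0 := by
  intro hl
  have := leftDeriv_nonpos h0 (hnn.filter_mono nhdsWithin_le_nhds) hl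
  linarith

/-- On the clean side the first-order surplus is realised: if `D c = ℓ |c| + o(c)` from the left
with `ℓ > 0` then `D c > 0` for all small `c < 0` (the members are strictly sub-extremal).
[folklore] -/
theorem eventually_pos_of_leftDeriv {D : ℝ → ℝ} {ℓ : ℝ} (h0 : D 0 = 0) (hℓ : 0 < ℓ)
    (hl : HasDerivWithinAt D (-ℓ) (Iio 0) 0) : ∀ᶠ c in 𝓝[<] (0 : ℝ), 0 < D c := by
  rw [hasDerivWithinAt_iff_tendsto_slope] at hl
  have hs : Iio (0 : ℝ) \ {0} = Iio 0 := by
    ext x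
    simp only [Set.mem_diff, mem_Iio, mem_singleton_iff, and_iff_left_iff_imp]
    exact fun hx ↦ ne_of_lt hx
  rw [hs] at hl
  -- slope → -ℓ < 0, so eventually slope < 0, i.e. D c / c < 0 with c < 0, i.e. D c > 0
  have hev : ∀ᶠ c in 𝓝[<] (0 : ℝ), slope D 0 c < 0 :=
    hl (Iio_mem_nhds (by linarith : -ℓ < 0))
  filter_upwards [hev, self_mem_nhdsWithin] with c hc hneg
  rw [slope_def_field, h0, sub_zero, sub_zero] at hc
  rcases div_neg_iff.mp hc with ⟨hpos, _⟩ | ⟨_, hcpos⟩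
  · exact hpos
  · exact absurd hcpos (not_lt.mpr (le_of_lt (mem_Iio.mp hneg)))

/-! ### §2 Uniform one-sided cleanliness ⇒ δ-separation ⇒ isolation -/

/-- **δ-separation.** If every bad parameter `x` with `|x| < ε` has a clean LEFT δ-neighbourhood
(no bad parameter in `(x − δ, x)`), then `0 ∈ B` is an ISOLATED point of `B`: bad parameters to the
left of `0` are at distance `≥ δ`, and `(0, min ε δ)` contains at most one bad parameter.  Nothing
about what happens AT the bad parameters on the right is used. [folklore] -/
theorem isolated_of_uniform_clean_left {B : Set ℝ} {ε δ : ℝ} (hε : 0 < ε) (hδ : 0 < δ)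
    (h0 : (0 : ℝ) ∈ B) (h : ∀ x ∈ B, |x| < ε → ∀ y ∈ B, y < x → y ≤ x - δ) :
    ∃ η > 0, ∀ c ∈ B, |c| < η → c = 0 := by
  have hleft : ∀ c ∈ B, c < 0 → c ≤ -δ := fun c hcB hneg ↦ by
    have := h 0 h0 (by simpa using hε) c hcB hneg
    linarith
  by_cases hex : ∃ x ∈ B, 0 < x ∧ x < min ε δ
  · obtain ⟨x, hxB, hx0, hxm⟩ := hex
    have hxε : x < ε := lt_of_lt_of_le hxm (min_le_left _ _)
    have hxδ : x < δ := lt_of_lt_of_le hxm (min_le_right _ _)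
    refine ⟨min x δ, lt_min hx0 hδ, fun c hcB hc ↦ ?_⟩
    have hc' := abs_lt.mp hc
    rcases lt_trichotomy c 0 with hneg | rfl | hpos
    · have h₁ := hleft c hcB hneg
      have h₂ : -δ < c := by
        have := lt_of_lt_of_le hc (min_le_right x δ)
        have := (abs_lt.mp this).1
        linarith
      linarith
    · rfl
    · have hcx : c < x := lt_of_lt_of_le hc'.2 (min_le_left _ _)
      have := h x hxB (by rwa [abs_of_pos hx0]) c hcB hcx
      linarith
  · push Not at hex
    refine ⟨min ε δ, lt_min hε hδ, fun c hcB hc ↦ ?_⟩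
    rcases lt_trichotomy c 0 with hneg | rfl | hpos
    · have h₁ := hleft c hcB hneg
      have h₂ : -δ < c := by
        have := lt_of_lt_of_le hc (min_le_right ε δ)
        have := (abs_lt.mp this).1
        linarith
      linarith
    · rfl
    · exact absurd (lt_of_le_of_lt (le_abs_self c) hc) (not_lt.mpr (hex c hcB hpos))

/-- Mirror image (clean RIGHT neighbourhoods, the case `ℓ < 0`). [folklore] -/
theorem isolated_of_uniform_clean_right {B : Set ℝ} {ε δ : ℝ} (hε : 0 < ε) (hδ : 0 < δ)
    (h0 : (0 : ℝ) ∈ B) (h : ∀ x ∈ B, |x| < ε → ∀ y ∈ B, x < y → x + δ ≤ y) :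
    ∃ η > 0, ∀ c ∈ B, |c| < η → c = 0 := by
  -- reflect `B` through `0`
  obtain ⟨η, hη, hB⟩ := isolated_of_uniform_clean_left (B := {t | -t ∈ B}) hε hδ (by simpa using h0)
    (fun x hx hxε y hy hyx ↦ by
      have := h (-x) hx (by simpa using hxε) (-y) hy (by linarith)
      linarith)
  exact ⟨η, hη, fun c hcB hc ↦ by
    have := hB (-c) (by simpa using hcB) (by simpa using hc)
    linarith⟩

/-! ### §3 Data-level assembly over the tree's tame genericity -/

section Assembly

open Literature.Geometry.Lorentzian
open scoped Manifold ContDiff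

variable {X : Type*} [TopologicalSpace X] [ChartedSpace E3 X] [IsManifold (𝓡 3) ∞ X]

private theorem eq_single_apply_zero (c : EuclideanSpace ℝ (Fin 1)) :
    c = EuclideanSpace.single 0 (c 0) := by
  ext j
  have hj : j = 0 := Subsingleton.elim _ _
  subst hj
  simp

private theorem norm_eq_abs_apply_zero (c : EuclideanSpace ℝ (Fin 1)) : ‖c‖ = |c 0| := by
  conv_lhs => rw [eq_single_apply_zero c]
  rw [EuclideanSpace.norm_single, Real.norm_eq_abs]

/-- **Tame genericity from uniform one-sided corners.** Let `P` be a property of data in the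
admissible class `𝓓`.  Suppose that through every exceptional datum `d` (`d ∈ 𝓓`, `¬ P d`) passes
a tame, immersed, injective pencil `F : ℝ¹ → 𝓓`, `F 0 = d`, with the UNIFORM CLEAN-SIDE property:
for some `ε, δ > 0`, every exceptional member `F c` with `|c| < ε` has no exceptional member at
parameters in `(c − δ, c)` (respectively `(c, c + δ)`).  Then `P` is tame-generic with codimension
`1` (`InitialDataSet.IsTameChristodoulouGeneric 𝓓 P 1`).  Proof: δ-separation
(`isolated_of_uniform_clean_left/right`) makes `0` an isolated exceptional parameter, and tame
genericity is local in the parameter (`isTameChristodoulouGeneric_of_local`, radial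
reparametrisation).  This is the shape in which the line consumes its two physical stubs — (K0) a
radiating threshold datum has a direction with non-zero interference functional `ℓ`, fixing the
clean side, and (K2) the clean side is realised with a radius uniform along nearby threshold data —
and it never inspects the other side of the corner. [folklore] -/
theorem isTameChristodoulouGeneric_of_uniform_clean_side
    {𝓓 : Set (InitialDataSet (𝓡 3) X)} {P : InitialDataSet (𝓡 3) X → Prop}
    (h : ∀ d ∈ 𝓓, ¬ P d → ∃ (e : AFEnd X) (F : EuclideanSpace ℝ (Fin 1) → InitialDataSet (𝓡 3) X),
      InitialDataSet.IsTameDataFamily e 1 F ∧ InitialDataSet.IsImmersedAtZero 1 F ∧ F 0 = d ∧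
      Injective F ∧ (∀ c, F c ∈ 𝓓) ∧
      ∃ ε > (0 : ℝ), ∃ δ > (0 : ℝ),
        (∀ c : EuclideanSpace ℝ (Fin 1), ¬ P (F c) → |c 0| < ε →
            ∀ c' : EuclideanSpace ℝ (Fin 1), ¬ P (F c') → c' 0 < c 0 → c' 0 ≤ c 0 - δ) ∨
        (∀ c : EuclideanSpace ℝ (Fin 1), ¬ P (F c) → |c 0| < ε →
            ∀ c' : EuclideanSpace ℝ (Fin 1), ¬ P (F c') → c 0 < c' 0 → c 0 + δ ≤ c' 0)) :
    InitialDataSet.IsTameChristodoulouGeneric 𝓓 P 1 := by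
  refine InitialDataSet.isTameChristodoulouGeneric_of_local fun d hd hPd ↦ ?_
  obtain ⟨e, F, hF, himm, hF0, hinj, h𝓓, ε, hε, δ, hδ, hsep⟩ := h d hd hPd
  refine ⟨e, F, hF, himm, hF0, hinj, h𝓓, ?_⟩
  -- the real-line trace of the exceptional set along the pencil
  set B : Set ℝ := {t | ¬ P (F (EuclideanSpace.single 0 t))} with hB
  have h0B : (0 : ℝ) ∈ B := by
    change ¬ P (F (EuclideanSpace.single 0 0))
    have : EuclideanSpace.single (0 : Fin 1) (0 : ℝ) = 0 := by
      ext j; simp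
    rw [this, hF0]
    exact hPd
  have hiso : ∃ η > 0, ∀ c ∈ B, |c| < η → c = 0 := by
    rcases hsep with hL | hR
    · refine isolated_of_uniform_clean_left hε hδ h0B fun x hx hxε y hy hyx ↦ ?_
      have := hL (EuclideanSpace.single 0 x) hx (by simpa using hxε)
        (EuclideanSpace.single 0 y) hy (by simpa using hyx)
      simpa using this
    · refine isolated_of_uniform_clean_right hε hδ h0B fun x hx hxε y hy hxy ↦ ?_
      have := hR (EuclideanSpace.single 0 x) hx (by simpa using hxε)
        (EuclideanSpace.single 0 y) hy (by simpa using hxy)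
      simpa using this
  obtain ⟨η, hη, hiso⟩ := hiso
  refine ⟨η, hη, fun c hc hcη ↦ ?_⟩
  by_contra hPc
  have hcB : c 0 ∈ B := by
    change ¬ P (F (EuclideanSpace.single 0 (c 0)))
    rwa [← eq_single_apply_zero c]
  have := hiso (c 0) hcB (by rwa [← norm_eq_abs_apply_zero c])
  apply hc
  rw [eq_single_apply_zero c, this]
  ext j; simp

end Assembly

end Summit.FinalStateConjecture.FinalStateConjecture.Cruxes.TameCensorshipCollarMargin.SilenceOrCorner
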